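import Literature.Computability.QuantumComplexity.OneCleanQubit
import Literature.Computability.Cryptography.QuantumCircuitProofs
import Literature.Computability.Cryptography.QubitRegisterCliffordTProofs
import Literature.Computability.QuantumComplexity.RegisterPathSum
import HarnessLib

/-!
# The one-clean-qubit model, II: acceptance functionals, polarization `α`, and `DQC1_α = DQC1`

Topic `Literature/Computability/QuantumComplexity`; sequel to `OneCleanQubit.lean` (which defines
`IsDQC1Decidable L` — verbatim the model inlined in route QuantumAdvantage/SeparableFrames — and the
class `DQC1 = {L | IsDQC1Decidable L}`, Knill–Laflamme 1998 / Shor–Jordan 2008 §1), serving the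
definition request `defn-OneCleanQubit` (its optional "polarization-`α` variant" and API). Here:

* `oneCleanQubitAcceptProb C` — for a circuit `C` on `1 + k` wires: the probability that wire `0`
  reads `1` after running `C` on `|0⟩⟨0| ⊗ I/2^k` (wire `0` clean, wires `1, …, k` maximally
  mixed), as the uniform average over the `2^k` basis inputs `r` of the register of the Born
  probability of "wire `0` is `true`" — the quantity written out inside `IsDQC1Decidable`
  (Shor–Jordan 2008, §1, eq. (1) and p. 3: "choosing `|ψ⟩` uniformly at random from the `2^n`
  computational basis states is exactly the same as inputting the density matrix `I/2^n`");
  `mem_DQC1_iff'` refolds `DQC1` through it;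
* `polarizedCleanQubitAcceptProb α C` — the same with the clean wire prepared in
  `½(I + αZ) = (1+α)/2·|0⟩⟨0| + (1−α)/2·|1⟩⟨1|`, polarization `α` (Datta–Flammia–Caves 2005, §2;
  Knill–Laflamme 1998, p. 3); `α = 1` is the previous quantity (`polarizedCleanQubitAcceptProb_one`);
* `DQC1PolOver G α` (any gate set) and **`DQC1Pol α`** (Clifford+T; the `OneCleanQubitPol α` of the
  request) — the class `DQC1_α`: as `DQC1` but with clean-wire polarization `α`, i.e. the model of
  route SeparableFrames' crux `SeparableInstancesInBPP`; `DQC1Pol_one : DQC1Pol 1 = DQC1`;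
* all proved: `0 ≤ oneCleanQubitAcceptProb C ≤ 1`, the affine law
  `polarizedCleanQubitAcceptProb α C = 1/2 + α·(oneCleanQubitAcceptProb C − 1/2)` over a unitary
  gate set (the totally mixed input is a fixed point of a unitary channel, so the `|1⟩`-branch bias
  is minus the `|0⟩`-branch bias), whence **`DQC1Pol α = DQC1` for every constant `0 < α ≤ 1`**:
  "it is not necessary to have even one fully polarized qubit to obtain the class DQC1. As shown in
  [Knill–Laflamme], a single partially polarized qubit suffices" (Shor–Jordan 2008, p. 3;
  Datta–Flammia–Caves 2005, §2: subunity polarization scales the signal by `α`). No named fact is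
  introduced.

## Design choices / what is NOT here

* State vectors only (as in Q2): mixed wires are uniform mixtures of basis inputs; by linearity
  this is the density-matrix formula. Register size `1 + k` (clean wire first) and inputs
  `Fin.append (fun _ : Fin 1 => b) r`, the literal shape of `IsDQC1Decidable` and of the route.
* For `|α| > 1` the weights `(1 ± α)/2` are not probabilities; the definitions still make sense
  as real numbers (junk regime, never used). Polarization decreasing with `n` (`α = 1/poly`, also
  covered by Knill–Laflamme's remark) is not formalised: `α` is a constant.
* Not here (results in print, left to their own items): `P ⊆ DQC1`, `DQC_{O(log n)} = DQC1`,
  DQC1-completeness of normalised trace estimation (Shor–Jordan §1); `DQC1 ⊆ BQP` is the named fact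
  `knillLaflamme1998_DQC1_subset_BQP` of `OneCleanQubit.lean`.

## References

* E. Knill, R. Laflamme, *Power of one bit of quantum information*, Phys. Rev. Lett. 81 (1998)
  5672–5675, arXiv:quant-ph/9802037, pp. 2–3 (DQC1; partially polarized bit). [KnillLaflamme1998]
* P. W. Shor, S. P. Jordan, *Estimating Jones polynomials is a complete problem for one clean
  qubit*, Quantum Inf. Comput. 8 (2008) 681–714, arXiv:0707.2831, §1 pp. 2–4. [ShorJordan2008]
* A. Datta, S. T. Flammia, C. M. Caves, *Entanglement and the power of one qubit*, Phys. Rev. A 72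
  (2005) 042316, arXiv:quant-ph/0505213, §2 (polarization `α`). [DattaFlammiaCaves2005]
-/

noncomputable section

namespace Literature.Computability.QuantumComplexity

open _root_.Computability Complexity Cryptography

variable {G : QGateSet} {k : ℕ}

/-! ### Acceptance probabilities of the one-clean-qubit model -/

/-- **One-clean-qubit acceptance probability.** For a circuit `C` on `1 + k` wires: the
probability that wire `0` reads `1` (`QCircuit.acceptEvent`) after running `C` on
`|0⟩⟨0| ⊗ I/2^k` — wire `0` prepared `|0⟩`, the register wires `1, …, k` maximally mixed, i.e. the
uniform average over the basis inputs `r ∈ {0,1}^k` of the Born probability on the pure input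
`|0⟩|r⟩`. This is `p₁ = 1 − p₀` for Shor–Jordan's
`p₀ = 2^{-n} tr[(|0⟩⟨0| ⊗ I) U (|0⟩⟨0| ⊗ I) U†]`.
[cite: ShorJordan2008, §1 eq. 1 and p. 3] -/
def oneCleanQubitAcceptProb (C : QCircuit G (1 + k)) : ℝ :=
  ∑ r : QReg k, (1 : ℝ) / 2 ^ k *
    C.probEvent 0 (basisState (Fin.append (fun _ : Fin 1 => false) r)) (QCircuit.acceptEvent (1 + k))

/-- **Acceptance probability with a partially polarized clean qubit.** As
`oneCleanQubitAcceptProb`, but wire `0` is prepared in the state `½(I + αZ)`, i.e. `|0⟩` with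
weight `(1+α)/2` and `|1⟩` with weight `(1−α)/2` (polarization `α`; `α = 1` is the clean qubit,
`α = 0` the totally mixed input): the weighted average over `b ∈ {0,1}` and `r ∈ {0,1}^k` of the
Born probability that wire `0` reads `1` on the pure input `|b⟩|r⟩`.
[cite: DattaFlammiaCaves2005, §2 arXiv p. 4] -/
def polarizedCleanQubitAcceptProb (α : ℝ) (C : QCircuit G (1 + k)) : ℝ :=
  ∑ b : Bool, ∑ r : QReg k, (if b then 1 - α else 1 + α) / (2 * 2 ^ k) *
    C.probEvent 0 (basisState (Fin.append (fun _ : Fin 1 => b) r)) (QCircuit.acceptEvent (1 + k))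

/-! ### The classes `DQC1_α` -/

/-- **`DQC1_α` over the gate set `G`**: as `DQC1` (`IsDQC1Decidable`), over an arbitrary
(encodable) gate set and with the clean wire of polarization `α`: register sizes `k x`, oracle-free
circuits `C x` over `G` on `1 + k x` wires generated in classical polynomial time from the input
(`x ↦ sigmaEncode ⟨1, k x, C x⟩ ∈ FP`), and a polynomial `q` with
`polarizedCleanQubitAcceptProb α (C x) ≥ 1/2 + 1/(q |x| + 1)` on `x ∈ L` and
`≤ 1/2 − 1/(q |x| + 1)` off `L`. [cite: ShorJordan2008, §1 pp. 2–3] [cite: DattaFlammiaCaves2005, §2] -/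
def DQC1PolOver (G : QGateSet) [Encodable G.Op] (α : ℝ) : Set (Language Bool) :=
  {L | ∃ (k : List Bool → ℕ) (C : (x : List Bool) → QCircuit G (1 + k x)),
    (∀ x, (C x).IsOracleFree) ∧
    (fun x : List Bool => QCircuit.sigmaEncode (G := G) ⟨1, k x, C x⟩) ∈ FP ∧
    ∃ q : Polynomial ℕ, ∀ x : List Bool,
      (x ∈ L → (1 : ℝ) / 2 + 1 / (((q.eval x.length : ℕ) : ℝ) + 1) ≤
        polarizedCleanQubitAcceptProb α (C x)) ∧
      (x ∉ L → polarizedCleanQubitAcceptProb α (C x) ≤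
        (1 : ℝ) / 2 - 1 / (((q.eval x.length : ℕ) : ℝ) + 1))}

/-- **`DQC1Pol α = DQC1_α`** (the `OneCleanQubitPol α` of the definition request): the
one-clean-qubit class over Clifford+T with the clean wire prepared in
`(1+α)/2·|0⟩⟨0| + (1−α)/2·|1⟩⟨1|` — the polarization-`α` model of route SeparableFrames' crux
`SeparableInstancesInBPP`. `DQC1Pol 1 = DQC1` (`DQC1Pol_one`), and for `0 < α ≤ 1` still
`DQC1Pol α = DQC1` (`DQC1Pol_eq_DQC1`). [cite: DattaFlammiaCaves2005, §2] -/
def DQC1Pol (α : ℝ) : Set (Language Bool) :=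
  DQC1PolOver cliffordT α

/-! ### Unfolding lemmas -/

/-- Wire `0` of the input `|b⟩|r⟩` carries `b`. [folklore] -/
theorem append_apply_zero (b : Bool) (r : QReg k) (h : 0 < 1 + k) :
    Fin.append (fun _ : Fin 1 => b) r ⟨0, h⟩ = b := by
  have h0 : (⟨0, h⟩ : Fin (1 + k)) = Fin.castAdd k (0 : Fin 1) := Fin.ext rfl
  rw [h0, Fin.append_left]

/-- At polarization `1` the weights are `1/2^k` on `b = 0` and `0` on `b = 1`:
`polarizedCleanQubitAcceptProb 1 C = oneCleanQubitAcceptProb C`. [folklore] -/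
@[simp] theorem polarizedCleanQubitAcceptProb_one (C : QCircuit G (1 + k)) :
    polarizedCleanQubitAcceptProb 1 C = oneCleanQubitAcceptProb C := by
  unfold polarizedCleanQubitAcceptProb oneCleanQubitAcceptProb
  rw [Fintype.sum_bool]
  simp only [if_true, sub_self, zero_div, zero_mul, Finset.sum_const_zero, zero_add,
    Bool.false_eq_true, if_false]
  refine Finset.sum_congr rfl fun r _ => ?_
  congr 1
  ring

/-- Unfolding lemma for the tree's `DQC1` (definitional: `DQC1 = {L | IsDQC1Decidable L}`).
[cite: ShorJordan2008, §1 pp. 2–3] -/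
theorem mem_DQC1_iff {L : Language Bool} : L ∈ DQC1 ↔ IsDQC1Decidable L :=
  Iff.rfl

/-- **`DQC1` refolded through `oneCleanQubitAcceptProb`** (definitional). [cite: ShorJordan2008, §1 pp. 2–3] -/
theorem mem_DQC1_iff' {L : Language Bool} :
    L ∈ DQC1 ↔ ∃ (k : List Bool → ℕ) (C : (x : List Bool) → QCircuit cliffordT (1 + k x)),
      (∀ x, (C x).IsOracleFree) ∧
      (fun x : List Bool => QCircuit.sigmaEncode (G := cliffordT) ⟨1, k x, C x⟩) ∈ FP ∧
      ∃ q : Polynomial ℕ, ∀ x : List Bool,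
        (x ∈ L → (1 : ℝ) / 2 + 1 / (((q.eval x.length : ℕ) : ℝ) + 1) ≤
          oneCleanQubitAcceptProb (C x)) ∧
        (x ∉ L → oneCleanQubitAcceptProb (C x) ≤
          (1 : ℝ) / 2 - 1 / (((q.eval x.length : ℕ) : ℝ) + 1)) :=
  Iff.rfl

/-- Unfolding lemma for `DQC1Pol α` (definitional). [cite: DattaFlammiaCaves2005, §2] -/
theorem mem_DQC1Pol_iff {α : ℝ} {L : Language Bool} :
    L ∈ DQC1Pol α ↔
      ∃ (k : List Bool → ℕ) (C : (x : List Bool) → QCircuit cliffordT (1 + k x)),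
      (∀ x, (C x).IsOracleFree) ∧
      (fun x : List Bool => QCircuit.sigmaEncode (G := cliffordT) ⟨1, k x, C x⟩) ∈ FP ∧
      ∃ q : Polynomial ℕ, ∀ x : List Bool,
        (x ∈ L → (1 : ℝ) / 2 + 1 / (((q.eval x.length : ℕ) : ℝ) + 1) ≤
          polarizedCleanQubitAcceptProb α (C x)) ∧
        (x ∉ L → polarizedCleanQubitAcceptProb α (C x) ≤
          (1 : ℝ) / 2 - 1 / (((q.eval x.length : ℕ) : ℝ) + 1)) :=
  Iff.rfl

/-- **Full polarization is the clean qubit: `DQC1Pol 1 = DQC1`.** [folklore] -/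
@[simp] theorem DQC1Pol_one : DQC1Pol 1 = DQC1 := by
  ext L
  simp only [mem_DQC1Pol_iff, polarizedCleanQubitAcceptProb_one, mem_DQC1_iff']

/-! ### The totally mixed input is a fixed point: polarization only rescales the bias -/

/-- Splitting the wires of the one-clean-qubit register: a basis label of `1 + k` wires is a bit
on the clean wire `0` together with a label of the `k` register wires. [folklore] -/
def cleanSplitEquiv (k : ℕ) : Bool × QReg k ≃ QReg (1 + k) where
  toFun p := Fin.append (fun _ : Fin 1 => p.1) p.2
  invFun z := (z ⟨0, Nat.add_pos_left Nat.one_pos k⟩, fun j => z (Fin.natAdd 1 j))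
  left_inv p := by
    obtain ⟨b, r⟩ := p
    simp only [Prod.mk.injEq]
    exact ⟨append_apply_zero b r _, funext fun j => Fin.append_right _ _ j⟩
  right_inv z := by
    funext i
    refine Fin.addCases (fun i₁ => ?_) (fun j => ?_) i
    · simp only [Fin.append_left]
      exact congrArg z (Fin.ext (by change (0 : ℕ) = i₁.val; have := i₁.2; omega))
    · simp only [Fin.append_right]

/-- Summing over the clean bit and the register label is summing over all basis labels. [folklore] -/
theorem sum_bool_sum_append {M : Type*} [AddCommMonoid M] (f : QReg (1 + k) → M) :
    ∑ b : Bool, ∑ r : QReg k, f (Fin.append (fun _ : Fin 1 => b) r) = ∑ z : QReg (1 + k), f z :=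
  calc ∑ b : Bool, ∑ r : QReg k, f (Fin.append (fun _ : Fin 1 => b) r)
      = ∑ p : Bool × QReg k, f (Fin.append (fun _ : Fin 1 => p.1) p.2) :=
        (Fintype.sum_prod_type' (fun b r => f (Fin.append (fun _ : Fin 1 => b) r))).symm
    _ = ∑ z : QReg (1 + k), f z := Fintype.sum_equiv (cleanSplitEquiv k) _ _ fun _ => rfl

/-- The rows of a unitary matrix are unit vectors: `∑_z |U y z|² = (U U†)_{yy} = 1`.
(Nielsen–Chuang 2010, §2.1.6.) [folklore] -/
theorem sum_norm_sq_row_eq_one {N : ℕ} {U : Matrix (QReg N) (QReg N) ℂ}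
    (hU : U ∈ Matrix.unitaryGroup (QReg N) ℂ) (y : QReg N) : ∑ z, ‖U y z‖ ^ 2 = 1 := by
  have h : (U * star U) y y = 1 := by
    rw [Matrix.mem_unitaryGroup_iff.1 hU, Matrix.one_apply_eq]
  rw [Matrix.mul_apply] at h
  have h' : ∑ z, ((‖U y z‖ ^ 2 : ℝ) : ℂ) = 1 := by
    rw [← h]
    refine Finset.sum_congr rfl fun z _ => ?_
    rw [Matrix.star_apply, Complex.star_def, Complex.mul_conj, Complex.normSq_eq_norm_sq]
  exact_mod_cast h'

/-- **The totally mixed input gives acceptance probability exactly `1/2`.** Over a unitary gate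
set, the Born probabilities of "wire `0` reads `1`" summed over ALL `2^{1+k}` basis inputs equal
`2^k`: exchanging the sums, each accepting row of the unitary circuit matrix has unit norm, and
there are `2^k` accepting rows. [folklore] -/
theorem sum_bool_sum_probEvent_acceptEvent (hG : G.IsUnitary) (C : QCircuit G (1 + k)) :
    ∑ b : Bool, ∑ r : QReg k, C.probEvent 0 (basisState (Fin.append (fun _ : Fin 1 => b) r))
      (QCircuit.acceptEvent (1 + k)) = 2 ^ k := by
  classical
  have hU := QCircuit.toMatrix_mem_unitaryGroup_holds hG (0 : Language Bool) C
  have hmem : ∀ (b : Bool) (r : QReg k),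
      Fin.append (fun _ : Fin 1 => b) r ∈ QCircuit.acceptEvent (1 + k) ↔ b = true := by
    intro b r
    simp only [QCircuit.acceptEvent, Set.mem_setOf_eq]
    constructor
    · rintro ⟨h, hb⟩
      rwa [append_apply_zero] at hb
    · intro hb
      exact ⟨Nat.add_pos_left Nat.one_pos k, by rw [append_apply_zero]; exact hb⟩
  have ht : ∀ r : QReg k, (if Fin.append (fun _ : Fin 1 => true) r ∈ QCircuit.acceptEvent (1 + k)
      then (1 : ℝ) else 0) = 1 := fun r => if_pos ((hmem true r).2 rfl)
  have hf : ∀ r : QReg k, (if Fin.append (fun _ : Fin 1 => false) r ∈ QCircuit.acceptEvent (1 + k)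
      then (1 : ℝ) else 0) = 0 := fun r => if_neg fun h => Bool.false_ne_true ((hmem false r).1 h)
  rw [sum_bool_sum_append
    (fun z => C.probEvent 0 (basisState z) (QCircuit.acceptEvent (1 + k)))]
  simp only [QCircuit.probEvent, runOn_basisState_apply, Finset.sum_filter]
  rw [Finset.sum_comm]
  have hrow : ∀ y : QReg (1 + k),
      (∑ z : QReg (1 + k),
          if y ∈ QCircuit.acceptEvent (1 + k) then ‖C.toMatrix 0 y z‖ ^ 2 else 0) =
        if y ∈ QCircuit.acceptEvent (1 + k) then (1 : ℝ) else 0 := by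
    intro y
    by_cases hy : y ∈ QCircuit.acceptEvent (1 + k)
    · simp only [hy, if_true, sum_norm_sq_row_eq_one hU y]
    · simp only [hy, if_false, Finset.sum_const_zero]
  rw [Finset.sum_congr rfl fun y _ => hrow y,
    ← sum_bool_sum_append (fun y => if y ∈ QCircuit.acceptEvent (1 + k) then (1 : ℝ) else 0),
    Fintype.sum_bool]
  simp only [ht, hf, Finset.sum_const_zero, add_zero, Finset.sum_const, Finset.card_univ,
    nsmul_eq_mul, mul_one]
  simp

/-- **Polarization rescales the bias** (over a unitary gate set):
`polarizedCleanQubitAcceptProb α C = 1/2 + α · (oneCleanQubitAcceptProb C − 1/2)` — the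
`|1⟩`-branch and the `|0⟩`-branch acceptance probabilities average to the totally mixed value
`1/2` (`sum_bool_sum_probEvent_acceptEvent`). "The effect of subunity polarization is to reduce
the expectation values … by a factor of `α`." [cite: DattaFlammiaCaves2005, §2] -/
theorem polarizedCleanQubitAcceptProb_eq (hG : G.IsUnitary) (α : ℝ) (C : QCircuit G (1 + k)) :
    polarizedCleanQubitAcceptProb α C = 1 / 2 + α * (oneCleanQubitAcceptProb C - 1 / 2) := by
  have hsum := sum_bool_sum_probEvent_acceptEvent hG C
  rw [Fintype.sum_bool] at hsum
  unfold polarizedCleanQubitAcceptProb oneCleanQubitAcceptProb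
  rw [Fintype.sum_bool]
  simp only [if_true, Bool.false_eq_true, if_false]
  rw [← Finset.mul_sum, ← Finset.mul_sum, ← Finset.mul_sum]
  have h2k : (2 : ℝ) ^ k ≠ 0 := pow_ne_zero _ two_ne_zero
  rw [eq_sub_of_add_eq hsum]
  field_simp
  ring

/-- Acceptance probabilities are nonnegative. [folklore] -/
theorem oneCleanQubitAcceptProb_nonneg (C : QCircuit G (1 + k)) : 0 ≤ oneCleanQubitAcceptProb C :=
  Finset.sum_nonneg fun _ _ => mul_nonneg (by positivity) (QCircuit.probEvent_nonneg _ _ _ _)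

/-- Over a unitary gate set acceptance probabilities are at most `1`. [folklore] -/
theorem oneCleanQubitAcceptProb_le_one (hG : G.IsUnitary) (C : QCircuit G (1 + k)) :
    oneCleanQubitAcceptProb C ≤ 1 := by
  have hsum := sum_bool_sum_probEvent_acceptEvent hG C
  rw [Fintype.sum_bool] at hsum
  have hPt : 0 ≤ ∑ r : QReg k, C.probEvent 0 (basisState (Fin.append (fun _ : Fin 1 => true) r))
      (QCircuit.acceptEvent (1 + k)) :=
    Finset.sum_nonneg fun _ _ => QCircuit.probEvent_nonneg _ _ _ _
  unfold oneCleanQubitAcceptProb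
  rw [← Finset.mul_sum, div_mul_eq_mul_div, one_mul, div_le_one (by positivity)]
  linarith

/-! ### A partially polarized clean qubit gives the same class -/

/-- **`DQC1_α = DQC1_1` over any unitary gate set, for every constant polarization `0 < α ≤ 1`.**
By `polarizedCleanQubitAcceptProb_eq` the bias around `1/2` at polarization `α` is `α` times the
bias at polarization `1`: a bias `≥ 1/(q+1)` at polarization `α ≤ 1` is one at polarization `1`,
and a bias `≥ 1/(q+1)` at polarization `1` gives `≥ α/(q+1) ≥ 1/(N(q+1)+1)` at polarization `α`,
`N ≥ 1/α`. (Shor–Jordan 2008, p. 3: "it is not necessary to have even one fully polarized qubit to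
obtain the class DQC1. As shown in [Knill–Laflamme], a single partially polarized qubit
suffices"; Datta–Flammia–Caves 2005, §2.) [cite: ShorJordan2008, §1 p. 3] -/
theorem DQC1PolOver_eq_of_isUnitary [Encodable G.Op] (hG : G.IsUnitary) {α : ℝ}
    (hα : 0 < α) (hα1 : α ≤ 1) : DQC1PolOver G α = DQC1PolOver G 1 := by
  ext L
  simp only [DQC1PolOver, Set.mem_setOf_eq, polarizedCleanQubitAcceptProb_eq hG, one_mul]
  constructor
  · rintro ⟨k, C, hfree, hFP, q, hq⟩
    refine ⟨k, C, hfree, hFP, q, fun x => ⟨fun hx => ?_, fun hx => ?_⟩⟩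
    · have h := (hq x).1 hx
      have hε : (0 : ℝ) < 1 / (((q.eval x.length : ℕ) : ℝ) + 1) := by positivity
      have hp : 0 ≤ oneCleanQubitAcceptProb (C x) - 1 / 2 := by nlinarith
      nlinarith [mul_le_of_le_one_left hp hα1]
    · have h := (hq x).2 hx
      have hε : (0 : ℝ) < 1 / (((q.eval x.length : ℕ) : ℝ) + 1) := by positivity
      have hp : oneCleanQubitAcceptProb (C x) - 1 / 2 ≤ 0 := by nlinarith
      nlinarith [mul_le_mul_of_nonpos_right hα1 hp]
  · rintro ⟨k, C, hfree, hFP, q, hq⟩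
    obtain ⟨N, hN⟩ := exists_nat_ge (1 / α)
    have hN1 : 1 ≤ α * N := by rwa [div_le_iff₀ hα, mul_comm] at hN
    refine ⟨k, C, hfree, hFP, Polynomial.C N * (q + 1), fun x => ?_⟩
    have hev : ((((Polynomial.C N * (q + 1)).eval x.length : ℕ) : ℝ) + 1)
        = N * (((q.eval x.length : ℕ) : ℝ) + 1) + 1 := by
      simp only [Polynomial.eval_mul, Polynomial.eval_C, Polynomial.eval_add, Polynomial.eval_one]
      push_cast
      ring
    have hq0 : (0 : ℝ) < ((q.eval x.length : ℕ) : ℝ) + 1 := by positivity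
    have hkey : 1 / (N * (((q.eval x.length : ℕ) : ℝ) + 1) + 1)
        ≤ α * (1 / (((q.eval x.length : ℕ) : ℝ) + 1)) := by
      rw [mul_one_div, div_le_div_iff₀ (by positivity) hq0]
      nlinarith
    rw [hev]
    refine ⟨fun hx => ?_, fun hx => ?_⟩
    · have h := (hq x).1 hx
      nlinarith
    · have h := (hq x).2 hx
      nlinarith

/-- **A partially polarized clean qubit suffices: `DQC1Pol α = DQC1` for `0 < α ≤ 1`**
(Clifford+T is unitary, `cliffordT_isUnitary_holds`). [cite: ShorJordan2008, §1 p. 3] -/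
theorem DQC1Pol_eq_DQC1 {α : ℝ} (hα : 0 < α) (hα1 : α ≤ 1) : DQC1Pol α = DQC1 := by
  rw [← DQC1Pol_one]
  exact DQC1PolOver_eq_of_isUnitary cliffordT_isUnitary_holds hα hα1

end Literature.Computability.QuantumComplexity
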